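import Mathlib
import HarnessLib
import Summits.Parity.Statement
import Summits.Parity.GeneralizedHardyLittlewood.Theses.GoldbachSparseBridge

/-!
# Assembly of route-Parity-GoldbachSparseBridge (item stmt-Parity-29461)

`Assembly : SparseExceptions → SparseToEmpty → EventualToUniform → BoundedSiegelZeroQuality →
UpperGivenBoundedSiegel → FixedLower → GeneralizedHardyLittlewood` is literally the route's certified
deciding theorem `closes` (node G1.2.UL.1 «GoldbachSparseBridge», decomp-parity lens-5 g5: the record's
uniform lower residual leaf UL carved along the exceptional-set axis of the moving Goldbach family; rev 0).
One line; no mathematics beyond the route file.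
-/

namespace Summit.Parity.GeneralizedHardyLittlewood.Theses.GoldbachSparseBridge

/-- Assembly item stmt-Parity-29461 of route-Parity-GoldbachSparseBridge:
`SparseExceptions → SparseToEmpty → EventualToUniform → BoundedSiegelZeroQuality → UpperGivenBoundedSiegel →
FixedLower → GeneralizedHardyLittlewood`, by the route's deciding theorem `closes`. -/
theorem assembly_proof : Assembly :=
  fun h1 h2 h3 h4 h5 h6 => closes h1 h2 h3 h4 h5 h6

end Summit.Parity.GeneralizedHardyLittlewood.Theses.GoldbachSparseBridge
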